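import Mathlib
import HarnessLib
import Summits.HubbardSuperconductivity.HubbardSuperconductivity.Theorems.KLProgrammeKLRegimeTwoVolumeTopFrameGridDataAt
import Summits.HubbardSuperconductivity.HubbardSuperconductivity.Theorems.KLProgrammeKLRegimeTwoVolumeRateKit
import Summits.HubbardSuperconductivity.HubbardSuperconductivity.Theorems.KLProgrammeKLRegimeTwoVolumeTowerBaseGridInput
import Summits.HubbardSuperconductivity.HubbardSuperconductivity.Theorems.KLProgrammeKLRegimeTwoVolumeTowerSpineKit

/-!
# Route `KLProgramme` — crux K3, VL child `KLRegimeVolumeLimitV17F2` (stmt-HubbardSuperconductivity-20440), atom HB1, GRID HALF (assembly step G3-2):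
# KIT FOR THE ONE-INSTANCE CONSTRUCTOR OF `TowerGridDataM` — the `ε`-scaled row shapes from k3c4-p2's `gridLabelWt` rows, the field-weighted norms of the
# slot-supported budget profiles, and the geometric majorant of the UV-stepped grid action's output profile (cell gate-hubbard-kl, seat p3 g18; `--supports` 20440)

Every row-type field of `…TowerBaseGridDataMDefs.TowerGridDataM` is an `ε`-SCALED row sum (`ε = imagTimeWeight β M = β/(2M)`) of the `Λ₁` grid covariance
`G = Sᵀ C^{K}_{>Λ₁} S` with `N = klGridN M = 4M` grid times, while the supplier (`…TwoVolumeTopFrameGridDataAt.rowWt_uvCovAt_le`, k3c4-p2 g13) delivers the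
`gridLabelWt`-weighted rows `≤ (N/β)·A`; since `ε·(N/β) = 2` all nine shapes of `gridRowData_of_rowWt_colWt` become `≤ 2A` (tails `≤ 2A/(R′+1)`).  The budget
profiles `NV, ND, E, NW` are supported on the slots `m′ ∈ {1, 2}`, so their `normV` is a two-term sum; the output profile of the grid action given by
`frame_gridDataAt` is majorised by a geometric profile `ρ⁻²ᵐ·P` whose `normV` is `…RateKit.normV_geometricProfile_le`.

* §1 **`gridRowsScaled_of_rowWt`** — the seven `ε`-scaled row shapes (plain rows/cols, `tnorm` moment, `(1+tnorm mod Lc)` rows/cols, `tnorm mod Lc` moment,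
  all-times far tails) from the two `gridLabelWt` bounds `≤ (N/β)·A`;
* §2 `normV_add_profiles`, **`normV_slotOne_le`** (`normV κ ρ [m′=1]·c ≤ (e²(κ+ρ))²·c`);
* §3 **`gridOutputProfile_majorant`** — from `frame_gridDataAt`'s data at the coarse lattice (rows `≤ (N/β)·A`, the canonical input budget's `normV ≤ ε·Θ₀`,
  `θ̄ = 2eAΘ₀/κ² ≤ θb < 1`): the grid partition function is a unit and the `(1+diam_{tnorm})`-weighted output profile is `≤ ρ⁻²ᵐ′·(e·εΘ₀/(1−θb))`, whose
  `normV` at `(K, ρ₁)` is `≤ ε·(eΘ₀/(1−θb))/(1 − (e²(K+ρ₁)/ρ)²)` whenever `e²(K+ρ₁)/ρ < 1`.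

Proofs only; no definition.  Honest framing: bookkeeping; nothing asserts HB1, any stub of 20440, K3, VL or superconductivity.
[cite: BenfattoGiulianiMastropietro2006, §2.1 (2.5), §2.5 (2.52)–(2.55), §3 (3.3)]
-/

noncomputable section

namespace Summit.HubbardSuperconductivity.HubbardSuperconductivity.Theorems.TwoVolumeSource

set_option linter.dupNamespace false -- summit = problem name (single-conjunct summit), D-0017

open Finset Literature.MathematicalPhysics.QuantumLattice GrassmannAlgebra Literature.Probability.LatticeModels
  Literature.Probability.LatticeModels.BattleFederbush
open Literature.MathematicalPhysics.QuantumLattice.FermiRG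
open Summit.HubbardSuperconductivity.HubbardSuperconductivity.Theorems.KLProgrammeLegKernels
open Summit.HubbardSuperconductivity.HubbardSuperconductivity.Theorems.KLRegimeSplit
open Summit.HubbardSuperconductivity.HubbardSuperconductivity.Theorems.EngineV8
open Summit.HubbardSuperconductivity.HubbardSuperconductivity.Theorems.TwoVolumeDefect

/-! ## §1 The `ε`-scaled row shapes of a grid covariance from its `gridLabelWt` rows `≤ (N/β)·A` -/

/-- `ε·(N/β) = 2` for `ε = β/(2M)`, `N = 4M`. [folklore] -/
theorem imagTimeWeight_mul_klGridN_div {β : ℝ} (hβ : β ≠ 0) (M : ℕ) [NeZero M] (A : ℝ) :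
    imagTimeWeight β M * (((klGridN M : ℕ) : ℝ) / β * A) = 2 * A := by
  have hM : (M : ℝ) ≠ 0 := Nat.cast_ne_zero.2 (NeZero.ne M)
  simp only [imagTimeWeight, klGridN]
  push_cast
  field_simp

/-- **THE `ε`-SCALED ROW SHAPES OF A GRID COVARIANCE** from the two `gridLabelWt`-weighted bounds `≤ (N/β)·A` (`β > 0`, `Lc ∣ V`): plain rows and columns,
the `tnorm` first moment, the `(1 + tnorm mod Lc)`-weighted rows and columns, the `tnorm mod Lc` first moment — all `≤ 2A` after multiplication by
`ε = imagTimeWeight β M` — and the all-times far tails `ε·Σ_{R′ < tnorm} ≤ 2A/(R′+1)` (k3c4-p2's `gridRowData_of_rowWt_colWt` and `ε·(N/β) = 2`).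
[cite: BenfattoGiulianiMastropietro2006, §2.5 (2.52)–(2.55)] -/
theorem gridRowsScaled_of_rowWt {V M : ℕ} [NeZero V] [NeZero M] {β : ℝ} (hβ : 0 < β)
    (G : Matrix (GridLeg (GridPoint V (klGridN M))) (GridLeg (GridPoint V (klGridN M))) ℂ) {A : ℝ}
    (hrow : ∀ X, ∑ Y, ‖G X Y‖ * gridLabelWt V (klGridN M) β {gridLegPos X, gridLegPos Y} ≤ ((klGridN M : ℕ) : ℝ) / β * A)
    (hcol : ∀ Y, ∑ X, ‖G X Y‖ * gridLabelWt V (klGridN M) β {gridLegPos X, gridLegPos Y} ≤ ((klGridN M : ℕ) : ℝ) / β * A)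
    {Lc : ℕ} [NeZero Lc] (hLc : Lc ∣ V) :
    (∀ X, imagTimeWeight β M * ∑ Y, ‖G X Y‖ ≤ 2 * A) ∧
    (∀ Y, imagTimeWeight β M * ∑ X, ‖G X Y‖ ≤ 2 * A) ∧
    (∀ X, imagTimeWeight β M * ∑ Y, ‖G X Y‖ * (Torus.tnorm (X.1.1.2 - Y.1.1.2) : ℝ) ≤ 2 * A) ∧
    (∀ X, imagTimeWeight β M * ∑ Y, ‖G X Y‖ *
      (1 + (Torus.tnorm ((fun i => (((X.1.1.2 i).val : ℕ) : ZMod Lc)) - fun i => (((Y.1.1.2 i).val : ℕ) : ZMod Lc)) : ℝ)) ≤ 2 * A) ∧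
    (∀ Y, imagTimeWeight β M * ∑ X, ‖G X Y‖ *
      (1 + (Torus.tnorm ((fun i => (((X.1.1.2 i).val : ℕ) : ZMod Lc)) - fun i => (((Y.1.1.2 i).val : ℕ) : ZMod Lc)) : ℝ)) ≤ 2 * A) ∧
    (∀ X, imagTimeWeight β M * ∑ Y, ‖G X Y‖ *
      (Torus.tnorm ((fun i => (((X.1.1.2 i).val : ℕ) : ZMod Lc)) - fun i => (((Y.1.1.2 i).val : ℕ) : ZMod Lc)) : ℝ) ≤ 2 * A) ∧
    (∀ (R' : ℕ) X, imagTimeWeight β M * ∑ Y ∈ univ.filter (fun Y : GridLeg (GridPoint V (klGridN M)) => R' < Torus.tnorm (X.1.1.2 - Y.1.1.2)),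
      ‖G X Y‖ ≤ 2 * A / ((R' : ℝ) + 1)) := by
  obtain ⟨_, _, h3, h4, h5, h6, h7, h8, h9⟩ := gridRowData_of_rowWt_colWt G hβ.le hrow hcol hLc
  have hε0 : 0 ≤ imagTimeWeight β M := by
    have hM : (0 : ℝ) < M := Nat.cast_pos.2 (Nat.pos_of_ne_zero (NeZero.ne M))
    unfold imagTimeWeight; positivity
  have h2A : imagTimeWeight β M * (((klGridN M : ℕ) : ℝ) / β * A) = 2 * A := imagTimeWeight_mul_klGridN_div hβ.ne' M A
  have sc : ∀ S : ℝ, S ≤ ((klGridN M : ℕ) : ℝ) / β * A → imagTimeWeight β M * S ≤ 2 * A := fun S hS =>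
    (mul_le_mul_of_nonneg_left hS hε0).trans h2A.le
  refine ⟨fun X => sc _ (h3 X), fun Y => sc _ (h4 Y), fun X => sc _ (h5 X), fun X => sc _ (h6 X), fun Y => sc _ (h7 Y), fun X => sc _ (h8 X),
    fun R' X => ?_⟩
  have h := mul_le_mul_of_nonneg_left (h9 R' X) hε0
  rw [← mul_div_assoc, h2A] at h
  exact h

/-! ## §2 Field-weighted norms of slot-supported profiles -/

/-- `normV` is additive in the profile. [folklore] -/
theorem normV_add_profiles (Γ : Type*) [Fintype Γ] (κ ρ : ℝ) (N₁ N₂ : ℕ → ℝ) :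
    normV Γ κ ρ (fun m => N₁ m + N₂ m) = normV Γ κ ρ N₁ + normV Γ κ ρ N₂ := by
  unfold normV
  rw [← sum_add_distrib]
  exact sum_congr rfl fun m _ => by ring

/-- **`normV` of a profile supported on the slot `m′ = 1`**: `normV Γ κ ρ ([m′=1]·c) ≤ (e²(κ+ρ))²·c` (`c ≥ 0`, `κ, ρ ≥ 0`). [folklore] -/
theorem normV_slotOne_le {Γ : Type*} [Fintype Γ] {κ ρ : ℝ} (hκ : 0 ≤ κ) (hρ : 0 ≤ ρ) {c : ℝ} (hc : 0 ≤ c) :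
    normV Γ κ ρ (fun m' => if m' = 1 then c else 0) ≤ (Real.exp 2 * (κ + ρ)) ^ 2 * c := by
  have hsum : HasSum (fun m : ℕ => (Real.exp 2 * (κ + ρ)) ^ (2 * m) * (if m = 1 then c else 0)) ((Real.exp 2 * (κ + ρ)) ^ 2 * c) := by
    have h := hasSum_ite_eq 1 ((Real.exp 2 * (κ + ρ)) ^ 2 * c)
    refine h.congr_fun fun m => ?_
    by_cases hm : m = 1
    · subst hm; simp
    · simp [hm]
  exact normV_le_of_hasSum hκ hρ (fun m => by split_ifs <;> positivity) hsum

/-! ## §3 The output profile of the UV-stepped grid action: unit partition function and a geometric majorant -/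

/-- **UNIT GRID PARTITION FUNCTION AND THE GEOMETRIC MAJORANT OF THE OUTPUT PROFILE** at an admissible frame `K` on the lattice `V` (`klBetaMin ≤ β ≤ V`):
if the `gridLabelWt`-rows/columns of `G = Sᵀ C^{K}_{>Λ₁} S` are `≤ (N/β)·A` (`A > 0`), the canonical input budget has `normV(κ, ρ) ≤ ε·Θ₀` and
`2eAΘ₀/κ² ≤ θb < 1` (`κ = √(2(7+6593))`), then the grid partition function of `effAction G (V_N + 𝒩_K)` is a unit and its `(1+diam_{tnorm})`-weighted pinned
profile is `≤ ρ⁻¹^(2m′)·(e·(ε·Θ₀)/(1 − θb))` in every even degree. [cite: BenfattoGiulianiMastropietro2006, §2.5 (2.52)–(2.55)] -/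
theorem gridOutputProfile_majorant {V M : ℕ} [NeZero V] [NeZero M] {R : RenConsts} {U μ β : ℝ} {Nsc : ℕ} {K : TrigPolyC4v}
    (hK : FrameOK R U Nsc μ K) (hβ : klBetaMin ≤ β) (hβV : β ≤ V) {A : ℝ} (hA : 0 < A)
    (hrow : ∀ X, ∑ Y, ‖((hubbardGridSub V M β (klGridN M)).transpose * hubbardCovAboveCT V M β μ 0 K (klScale klE0 1) *
        hubbardGridSub V M β (klGridN M)) X Y‖ * gridLabelWt V (klGridN M) β {gridLegPos X, gridLegPos Y} ≤ ((klGridN M : ℕ) : ℝ) / β * A)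
    (hcol : ∀ Y, ∑ X, ‖((hubbardGridSub V M β (klGridN M)).transpose * hubbardCovAboveCT V M β μ 0 K (klScale klE0 1) *
        hubbardGridSub V M β (klGridN M)) X Y‖ * gridLabelWt V (klGridN M) β {gridLegPos X, gridLegPos Y} ≤ ((klGridN M : ℕ) : ℝ) / β * A)
    {ρ Θ₀ θb : ℝ} (hρ : 0 < ρ) (hΘ₀ : 0 ≤ Θ₀)
    (hx : normV (GridLeg (GridPoint V (klGridN M))) (Real.sqrt (2 * (7 + 6593))) ρ
      (fun m' : ℕ => if m' = 1 then |β| / (klGridN M : ℕ) * ∑ z : TorusSite 2 V, ‖framePosKernel V K z‖ * (1 + torusSiteDist z 0)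
        else if m' = 2 then |U| * |β| / (klGridN M : ℕ) else 0) ≤ imagTimeWeight β M * Θ₀)
    (hθb : Real.exp 1 * (2 * A) * Θ₀ / Real.sqrt (2 * (7 + 6593)) ^ 2 ≤ θb) (hθb1 : θb < 1) :
    IsUnit (effPartitionFn ℂ ((hubbardGridSub V M β (klGridN M)).transpose * hubbardCovAboveCT V M β μ 0 K (klScale klE0 1) *
        hubbardGridSub V M β (klGridN M)) (hubbardGridInteraction V (klGridN M) β U + hubbardGridCounterQuadratic V (klGridN M) β K)) ∧
      ∀ (m' : ℕ) (j : Fin (2 * m')) (x : GridLeg (GridPoint V (klGridN M))),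
        ∑ Y ∈ univ.filter (fun Y : Fin (2 * m') → GridLeg (GridPoint V (klGridN M)) => Y j = x),
          ‖kernel ℂ (effAction ℂ ((hubbardGridSub V M β (klGridN M)).transpose * hubbardCovAboveCT V M β μ 0 K (klScale klE0 1) *
              hubbardGridSub V M β (klGridN M)) (hubbardGridInteraction V (klGridN M) β U + hubbardGridCounterQuadratic V (klGridN M) β K)) (2 * m') Y‖ *
            (1 + labelDiam (fun Y₁ Y₂ : GridLeg (GridPoint V (klGridN M)) => (Torus.tnorm (Y₁.1.1.2 - Y₂.1.1.2) : ℝ)) (univ.image Y)) ≤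
          ρ⁻¹ ^ (2 * m') * (Real.exp 1 * (imagTimeWeight β M * Θ₀) / (1 - θb)) := by
  classical
  have hβ0 : 0 < β := pos_of_klBetaMin_le hβ
  have hM0 : (0 : ℝ) < M := Nat.cast_pos.2 (Nat.pos_of_ne_zero (NeZero.ne M))
  have hε0 : 0 ≤ imagTimeWeight β M := by unfold imagTimeWeight; positivity
  set κ : ℝ := Real.sqrt (2 * (7 + 6593)) with hκ
  have hκ0 : 0 < κ := Real.sqrt_pos.2 (by norm_num)
  have hΛ1 : 0 < klScale klE0 1 := klth_klScale_pos 1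
  have hΛe : klScale klE0 1 ≤ klE0 := by unfold klScale klE0; norm_num
  set αw : ℝ := ((klGridN M : ℕ) : ℝ) / β * A with hαw
  have hN0 : (0 : ℝ) < ((klGridN M : ℕ) : ℝ) := by simp only [klGridN]; push_cast; linarith
  have hαw0 : 0 < αw := mul_pos (div_pos hN0 hβ0) hA
  set x : ℝ := normV (GridLeg (GridPoint V (klGridN M))) κ ρ
      (fun m' : ℕ => if m' = 1 then |β| / (klGridN M : ℕ) * ∑ z : TorusSite 2 V, ‖framePosKernel V K z‖ * (1 + torusSiteDist z 0)
        else if m' = 2 then |U| * |β| / (klGridN M : ℕ) else 0) with hxdef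
  have hx0 : 0 ≤ x := normV_nonneg hκ0.le hρ.le (towerGrid_inputBudget_nonneg β U K)
  -- the instance smallness `θ(x) ≤ θ(εΘ₀) = 2eAΘ₀/κ² ≤ θb < 1`
  have hθxb : Real.exp 1 * αw * (imagTimeWeight β M * Θ₀) / κ ^ 2 = Real.exp 1 * (2 * A) * Θ₀ / κ ^ 2 := by
    have h2 : αw * (imagTimeWeight β M * Θ₀) = 2 * A * Θ₀ := by
      rw [hαw, mul_comm, mul_assoc, mul_comm Θ₀, ← mul_assoc, imagTimeWeight_mul_klGridN_div hβ0.ne' M A]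
    rw [mul_assoc (Real.exp 1), h2, ← mul_assoc]
  have hθ1 : Real.exp 1 * αw * (imagTimeWeight β M * Θ₀) / κ ^ 2 < 1 := by rw [hθxb]; exact lt_of_le_of_lt hθb hθb1
  have hθx : Real.exp 1 * αw * x / κ ^ 2 < 1 := lt_of_le_of_lt (theta_mono hx hαw0.le) hθ1
  obtain ⟨_, hZ, hprof⟩ := frame_gridDataAt (L := V) (M := M) hK hβ hβV le_rfl hΛe hαw0 hrow hcol hρ hθx
  refine ⟨hZ, fun m' j y => (hprof m' j y).trans ?_⟩
  -- monotonicity in the budget and in the smallness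
  have h1 := stepBound_mono hx0 hx hαw0.le hκ0 hρ hθ1 (2 * m')
  refine h1.trans ?_
  have hden : 1 - θb ≤ 1 - Real.exp 1 * αw * (imagTimeWeight β M * Θ₀) / κ ^ 2 := by rw [hθxb]; linarith
  have hden0 : 0 < 1 - θb := by linarith
  rw [← mul_div_assoc]
  exact div_le_div_of_nonneg_left (by positivity) hden0 hden

/-- **`normV` OF THE GEOMETRIC MAJORANT**: `normV Γ K ρ₁ (m′ ↦ ρ⁻¹^(2m′)·(e·(εΘ₀)/(1−θb))) ≤ ε·((eΘ₀/(1−θb))/(1 − (e²(K+ρ₁)/ρ)²))` whenever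
`e²(K+ρ₁)·ρ⁻¹ < 1` (`…RateKit.normV_geometricProfile_le`). [folklore] -/
theorem normV_gridOutputMajorant_le (Γ : Type*) [Fintype Γ] {Kw ρ₁ ρ Θ₀ θb ε : ℝ} (hKρ : 0 ≤ Kw + ρ₁) (hρ : 0 < ρ) (hΘ₀ : 0 ≤ Θ₀) (hθb1 : θb < 1)
    (hε : 0 ≤ ε) (hq : Real.exp 2 * (Kw + ρ₁) * ρ⁻¹ < 1) :
    normV Γ Kw ρ₁ (fun m' : ℕ => ρ⁻¹ ^ (2 * m') * (Real.exp 1 * (ε * Θ₀) / (1 - θb))) ≤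
      ε * (Real.exp 1 * Θ₀ / (1 - θb) / (1 - (Real.exp 2 * (Kw + ρ₁) * ρ⁻¹) ^ 2)) := by
  have hden0 : 0 < 1 - θb := by linarith
  have hP : 0 ≤ Real.exp 1 * (ε * Θ₀) / (1 - θb) := by positivity
  refine (normV_geometricProfile_le (Γ := Γ) hKρ hρ hP hq).trans (le_of_eq ?_)
  have hq1 : 1 - (Real.exp 2 * (Kw + ρ₁) * ρ⁻¹) ^ 2 ≠ 0 := by
    have h0 : 0 ≤ Real.exp 2 * (Kw + ρ₁) * ρ⁻¹ := by positivity
    nlinarith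
  field_simp

end Summit.HubbardSuperconductivity.HubbardSuperconductivity.Theorems.TwoVolumeSource

end
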